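import Summits.CriticalPhenomena.Ising3D.TaylorKernelPDExpansion
import Summits.CriticalPhenomena.Ising3D.TaylorQPolyIntervalList
import Mathlib.Tactic.Linarith
import Mathlib.Tactic.Positivity
import Mathlib.Tactic.Ring
import HarnessLib

/-!
# Interval twin of the kernel's `(P, D)`-coefficient table (kernel-computable enclosures of `κ_{m,k}(s)`)
(cell `pub-ising3x`, seat recog-1 gen 11; gate (g2): the computable side of `TaylorKernelPDExpansion`)

HONEST FRAMING: lottery ticket; floor = tightest certified 3D Ising CFT bounds; no exact-solution
claim without a proof.

`TaylorKernelPDExpansion` writes the kernel `K_c` (and its symmetrisation) in the variables `(P, D) = (u+v-cc, u-v)`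
with an explicit real coefficient table `coeff2 (kernelPDL c l s σ cc) m k` — entries polynomial in the box
parameter `s`. Here is the COMPUTABLE interval twin over `MI` (scale `S`): bivariate interval lists
`IPoly2 = List IPoly` with `PMem2`, the operations `add2I`, `smul2QI`, `mulInner2I`, `mul2I`, `shift2I`, `altYI`,
`sumList2I` mirroring the real shadows of `TaylorKernelPDExpansion` (each with its `pmem2_*` theorem), the rows
`kernelPDRowI` and the table `kernelPDLI S cQ σQ C ccQ l` with **`pmem2_kernelPDLI`** (inputs: rational weights
`cQ`, sign `σQ`, centre `ccQ`, index list `l`, and `C i ∋ (-1)^i C(s,i)` — e.g. `signedChooseI S sI` for `s ∈ sI`),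
entry access `coeff2I` with `mem_coeff2_of_pmem2`, and `size2_eq_of_pmem2` (the shadow's `size2` is the twin's).
So every `κ_{m,k}(s)`, `s` in a box, is enclosed by running the list algorithm once in the kernel — what the
region checks on `K_sym` (`TaylorKernelSymm`) and the coefficient-domination route (`qM_half_of_kernelExpansion`)
consume. Elementary. [folklore]
-/

namespace Summit.CriticalPhenomena.Ising3D

open Finset
open Literature.Analysis.ValidatedNumerics Literature.Analysis.ValidatedNumerics.PolyMP
open Literature.Analysis.ValidatedNumerics.NumericsMP (MI)
open Literature.MathematicalPhysics.QuantumFieldTheory.ConformalBootstrap3D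

/-! ### Bivariate interval lists -/

/-- Bivariate interval lists (rows = interval polynomials in the first variable). [folklore] -/
abbrev IPoly2 := List IPoly

/-- Row-wise coefficientwise membership. [folklore] -/
def PMem2 (S : ℕ) (Q : List (List ℝ)) (QI : IPoly2) : Prop := List.Forall₂ (PMem S) Q QI

/-- [folklore] -/
theorem pmem2_nil (S : ℕ) : PMem2 S [] [] := List.Forall₂.nil

/-- [folklore] -/
theorem pmem2_cons {S : ℕ} {p : List ℝ} {P : IPoly} {Q : List (List ℝ)} {QI : IPoly2} (hp : PMem S p P)
    (hQ : PMem2 S Q QI) : PMem2 S (p :: Q) (P :: QI) := List.Forall₂.cons hp hQ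

/-- Row-wise sum. [folklore] -/
def add2I : IPoly2 → IPoly2 → IPoly2
  | [], Q => Q
  | p :: P, [] => p :: P
  | p :: P, q :: Q => addI p q :: add2I P Q

/-- [folklore] -/
theorem pmem2_add2I {S : ℕ} : ∀ {P Q : List (List ℝ)} {PI QI : IPoly2}, PMem2 S P PI → PMem2 S Q QI →
    PMem2 S (add2 P Q) (add2I PI QI)
  | _, _, _, _, List.Forall₂.nil, hQ => by simpa [add2, add2I] using hQ
  | _, _, _, _, List.Forall₂.cons (a := p) (b := I) (l₁ := P) (l₂ := PI) hp hP, List.Forall₂.nil => by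
      simp only [add2, add2I]
      exact List.Forall₂.cons hp hP
  | _, _, _, _, List.Forall₂.cons (a := p) (b := I) hp hP, List.Forall₂.cons (a := q) (b := J) hq hQ => by
      simp only [add2, add2I]
      exact List.Forall₂.cons (pmem_addI hp hq) (pmem2_add2I hP hQ)

/-- Row-wise exact rational scaling. [folklore] -/
def smul2QI (q : ℚ) (QI : IPoly2) : IPoly2 := QI.map (smulQI q)

/-- [folklore] -/
theorem pmem2_smul2QI {S : ℕ} (q : ℚ) {r : ℝ} (hq : (q : ℝ) = r) :
    ∀ {Q : List (List ℝ)} {QI : IPoly2}, PMem2 S Q QI → PMem2 S (smul2 r Q) (smul2QI q QI)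
  | _, _, List.Forall₂.nil => by simpa [smul2, smul2QI] using pmem2_nil S
  | _, _, List.Forall₂.cons (a := p) (b := P) hp hQ => by
      simp only [smul2, smul2QI, List.map_cons]
      exact List.Forall₂.cons (pmem_smulQI q hq hp) (pmem2_smul2QI q hq hQ)

/-- Row-wise product with an interval polynomial in the first variable. [folklore] -/
def mulInner2I (S : ℕ) (p : IPoly) (QI : IPoly2) : IPoly2 := QI.map (mulI S p)

/-- [folklore] -/
theorem pmem2_mulInner2I {S : ℕ} (hS : 0 < S) {p : List ℝ} {P : IPoly} (hp : PMem S p P) :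
    ∀ {Q : List (List ℝ)} {QI : IPoly2}, PMem2 S Q QI → PMem2 S (mulInner2 p Q) (mulInner2I S P QI)
  | _, _, List.Forall₂.nil => by simpa [mulInner2, mulInner2I] using pmem2_nil S
  | _, _, List.Forall₂.cons (a := q) (b := J) hq hQ => by
      simp only [mulInner2, mulInner2I, List.map_cons]
      exact List.Forall₂.cons (pmem_mulI hS hp hq) (pmem2_mulInner2I hS hp hQ)

/-- Bivariate product. [folklore] -/
def mul2I (S : ℕ) : IPoly2 → IPoly2 → IPoly2
  | [], _ => []
  | p :: P, Q => add2I (mulInner2I S p Q) ([] :: mul2I S P Q)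

/-- [folklore] -/
theorem pmem2_mul2I {S : ℕ} (hS : 0 < S) : ∀ {P Q : List (List ℝ)} {PI QI : IPoly2}, PMem2 S P PI →
    PMem2 S Q QI → PMem2 S (mul2 P Q) (mul2I S PI QI)
  | _, _, _, _, List.Forall₂.nil, _ => by simpa [mul2, mul2I] using pmem2_nil S
  | _, _, _, _, List.Forall₂.cons (a := p) (b := I) hp hP, hQ => by
      simp only [mul2, mul2I]
      exact pmem2_add2I (pmem2_mulInner2I hS hp hQ) (pmem2_cons (pmem_nil S) (pmem2_mul2I hS hP hQ))

/-- Prepend the thin zero to every row. [folklore] -/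
def consZero2I (S : ℕ) (QI : IPoly2) : IPoly2 := QI.map fun l => MI.ofInt S 0 :: l

/-- [folklore] -/
theorem pmem2_consZero2I {S : ℕ} : ∀ {Q : List (List ℝ)} {QI : IPoly2}, PMem2 S Q QI →
    PMem2 S (Q.map fun l => ((0 : ℝ) :: l)) (consZero2I S QI)
  | _, _, List.Forall₂.nil => by simpa [consZero2I] using pmem2_nil S
  | _, _, List.Forall₂.cons (a := q) (b := J) hq hQ => by
      simp only [consZero2I, List.map_cons]
      refine List.Forall₂.cons (pmem_cons ?_ hq) (pmem2_consZero2I hQ)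
      simpa using MI.mem_ofInt S 0

/-- One Horner step of `p(X + Y)` on intervals. [folklore] -/
def shiftStep2I (S : ℕ) (I : MI) (QI : IPoly2) : IPoly2 := add2I [[I]] (add2I (consZero2I S QI) ([] :: QI))

/-- [folklore] -/
theorem pmem2_shiftStep2I {S : ℕ} {a : ℝ} {I : MI} (ha : MI.mem S a I) {Q : List (List ℝ)} {QI : IPoly2}
    (hQ : PMem2 S Q QI) : PMem2 S (shiftStep2 a Q) (shiftStep2I S I QI) := by
  unfold shiftStep2 shiftStep2I
  exact pmem2_add2I (pmem2_cons (pmem_cons ha (pmem_nil S)) (pmem2_nil S))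
    (pmem2_add2I (pmem2_consZero2I hQ) (pmem2_cons (pmem_nil S) hQ))

/-- `p(X + Y)` on intervals. [folklore] -/
def shift2I (S : ℕ) (P : IPoly) : IPoly2 := P.foldr (shiftStep2I S) []

/-- [folklore] -/
theorem pmem2_shift2I {S : ℕ} : ∀ {as : List ℝ} {P : IPoly}, PMem S as P → PMem2 S (shift2 as) (shift2I S P)
  | _, _, List.Forall₂.nil => by simpa [shift2, shift2I] using pmem2_nil S
  | _, _, List.Forall₂.cons (a := a) (b := I) (l₁ := as) (l₂ := P) ha hP => by
      have ih := pmem2_shift2I hP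
      simp only [shift2, shift2I, List.foldr_cons] at ih ⊢
      exact pmem2_shiftStep2I ha ih

/-- Row-wise multiplication by `-1`. [folklore] -/
def neg2I (QI : IPoly2) : IPoly2 := QI.map (smulIntI (-1))

/-- [folklore] -/
theorem pmem2_neg2I {S : ℕ} : ∀ {Q : List (List ℝ)} {QI : IPoly2}, PMem2 S Q QI → PMem2 S (smul2 (-1) Q) (neg2I QI)
  | _, _, List.Forall₂.nil => by simpa [smul2, neg2I] using pmem2_nil S
  | _, _, List.Forall₂.cons (a := q) (b := J) hq hQ => by
      simp only [smul2, neg2I, List.map_cons]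
      refine List.Forall₂.cons ?_ (pmem2_neg2I hQ)
      have h := pmem_smulIntI (-1 : ℤ) hq
      simpa using h

/-- `Y ↦ -Y` on intervals. [folklore] -/
def altYI : IPoly2 → IPoly2
  | [] => []
  | p :: P => p :: neg2I (altYI P)

/-- [folklore] -/
theorem pmem2_altYI {S : ℕ} : ∀ {Q : List (List ℝ)} {QI : IPoly2}, PMem2 S Q QI → PMem2 S (altY Q) (altYI QI)
  | _, _, List.Forall₂.nil => by simpa [altY, altYI] using pmem2_nil S
  | _, _, List.Forall₂.cons (a := q) (b := J) hq hQ => by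
      simp only [altY, altYI]
      exact pmem2_cons hq (pmem2_neg2I (pmem2_altYI hQ))

/-- Row-wise sum over an index list. [folklore] -/
def sumList2I {ι : Type*} (l : List ι) (F : ι → IPoly2) : IPoly2 := l.foldr (fun i acc => add2I (F i) acc) []

/-- [folklore] -/
theorem pmem2_sumList2I {S : ℕ} {ι : Type*} {f : ι → List (List ℝ)} {F : ι → IPoly2} :
    ∀ l : List ι, (∀ i ∈ l, PMem2 S (f i) (F i)) → PMem2 S (sumList2 l f) (sumList2I l F)
  | [], _ => pmem2_nil S
  | i :: l, h => by
      simp only [sumList2, sumList2I, List.foldr_cons]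
      exact pmem2_add2I (h i (List.mem_cons_self)) (pmem2_sumList2I l fun i' hi' => h i' (List.mem_cons_of_mem _ hi'))

/-! ### The kernel table -/

/-- Interval twin of `kernelPDRow (↑cQ) s (↑σQ) (↑ccQ) ab`. [folklore] -/
def kernelPDRowI (S : ℕ) (cQ : ℕ × ℕ → ℚ) (σQ : ℚ) (C : ℕ → MI) (ccQ : ℚ) (ab : ℕ × ℕ) : IPoly2 :=
  smul2QI (cQ ab * 2 ^ (ab.1 + ab.2) * (1 + σQ * (-1) ^ (ab.1 + ab.2)))
    (mul2I S (shift2I S (affineI S (qFactor₁ListI S C ab.1) (PolyMP.ofRat S (1 / 2)) (PolyMP.ofRat S (ccQ / 2))))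
      (altYI (shift2I S (affineI S (qFactor₁ListI S C ab.2) (PolyMP.ofRat S (1 / 2)) (PolyMP.ofRat S (ccQ / 2))))))

/-- [folklore] -/
theorem pmem2_kernelPDRowI {S : ℕ} (hS : 0 < S) {s : ℝ} {C : ℕ → MI} (cQ : ℕ × ℕ → ℚ) (σQ ccQ : ℚ)
    (ab : ℕ × ℕ) (hC : ∀ i, i ≤ max ab.1 ab.2 → MI.mem S ((-1) ^ i * Ring.choose s i) (C i)) :
    PMem2 S (kernelPDRow (fun ab => (cQ ab : ℝ)) s (σQ : ℝ) (ccQ : ℝ) ab) (kernelPDRowI S cQ σQ C ccQ ab) := by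
  have hC1 : ∀ i, i ≤ ab.1 → MI.mem S ((-1) ^ i * Ring.choose s i) (C i) :=
    fun i hi => hC i (hi.trans (le_max_left _ _))
  have hC2 : ∀ i, i ≤ ab.2 → MI.mem S ((-1) ^ i * Ring.choose s i) (C i) :=
    fun i hi => hC i (hi.trans (le_max_right _ _))
  have hhalf : MI.mem S (1 / 2 : ℝ) (PolyMP.ofRat S (1 / 2)) := by
    have h := mem_ofRat S (1 / 2 : ℚ); push_cast at h; exact h
  have hcc : MI.mem S ((ccQ : ℝ) / 2) (PolyMP.ofRat S (ccQ / 2)) := by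
    have h := mem_ofRat S (ccQ / 2); push_cast at h; exact h
  unfold kernelPDRow kernelPDRowI
  refine pmem2_smul2QI _ (by push_cast; ring) (pmem2_mul2I hS ?_ ?_)
  · exact pmem2_shift2I (pmem_affineI hS hhalf hcc (pmem_qFactor₁ListI hS hC1))
  · exact pmem2_altYI (pmem2_shift2I (pmem_affineI hS hhalf hcc (pmem_qFactor₁ListI hS hC2)))

/-- Interval twin of `kernelPDL (↑cQ) l s (↑σQ) (↑ccQ)`. [folklore] -/
def kernelPDLI (S : ℕ) (cQ : ℕ × ℕ → ℚ) (σQ : ℚ) (C : ℕ → MI) (ccQ : ℚ) (l : List (ℕ × ℕ)) : IPoly2 :=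
  sumList2I l (kernelPDRowI S cQ σQ C ccQ)

/-- **`PMem2 S (kernelPDL (↑cQ) l s σQ ccQ) (kernelPDLI S cQ σQ C ccQ l)`** given `C i ∋ (-1)^i C(s,i)` for all
`i ≤ max(a,b)`, `(a,b) ∈ l`. [folklore] -/
theorem pmem2_kernelPDLI {S : ℕ} (hS : 0 < S) {s : ℝ} {C : ℕ → MI} (cQ : ℕ × ℕ → ℚ) (σQ ccQ : ℚ)
    (l : List (ℕ × ℕ)) (hC : ∀ ab ∈ l, ∀ i, i ≤ max ab.1 ab.2 → MI.mem S ((-1) ^ i * Ring.choose s i) (C i)) :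
    PMem2 S (kernelPDL (fun ab => (cQ ab : ℝ)) l s (σQ : ℝ) (ccQ : ℝ)) (kernelPDLI S cQ σQ C ccQ l) :=
  pmem2_sumList2I l fun ab hab => pmem2_kernelPDRowI hS cQ σQ ccQ ab (hC ab hab)

/-- The same with the canonical choice `C = signedChooseI S sI`, `s ∈ sI`. [folklore] -/
theorem pmem2_kernelPDLI_of_mem {S : ℕ} (hS : 0 < S) {s : ℝ} {sI : MI} (hs : MI.mem S s sI)
    (cQ : ℕ × ℕ → ℚ) (σQ ccQ : ℚ) (l : List (ℕ × ℕ)) :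
    PMem2 S (kernelPDL (fun ab => (cQ ab : ℝ)) l s (σQ : ℝ) (ccQ : ℝ))
      (kernelPDLI S cQ σQ (signedChooseI S sI) ccQ l) :=
  pmem2_kernelPDLI hS cQ σQ ccQ l fun _ _ i _ => mem_signedChooseI hS hs i

/-! ### Entry access and sizes -/

/-- The thin zero interval. [folklore] -/
def zeroI : MI := ⟨0, 0⟩

/-- [folklore] -/
theorem mem_zeroI (S : ℕ) : MI.mem S 0 zeroI := by simp [MI.mem, zeroI]

/-- Entry `(k, m)` of a bivariate interval list (thin zero outside). [folklore] -/
def coeff2I (QI : IPoly2) (m k : ℕ) : MI := (QI.getD k []).getD m zeroI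

/-- [folklore] -/
theorem mem_getD_of_pmem {S : ℕ} : ∀ {as : List ℝ} {P : IPoly}, PMem S as P →
    ∀ m : ℕ, MI.mem S (as.getD m 0) (P.getD m zeroI)
  | _, _, List.Forall₂.nil, m => by simpa using mem_zeroI S
  | _, _, List.Forall₂.cons (a := a) (b := I) ha hP, 0 => by simpa using ha
  | _, _, List.Forall₂.cons (a := a) (b := I) ha hP, m + 1 => by
      simpa using mem_getD_of_pmem hP m

/-- [folklore] -/
theorem pmem_getD_of_pmem2 {S : ℕ} : ∀ {Q : List (List ℝ)} {QI : IPoly2}, PMem2 S Q QI →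
    ∀ k : ℕ, PMem S (Q.getD k []) (QI.getD k [])
  | _, _, List.Forall₂.nil, k => by simpa using pmem_nil S
  | _, _, List.Forall₂.cons (a := q) (b := J) hq hQ, 0 => by simpa using hq
  | _, _, List.Forall₂.cons (a := q) (b := J) hq hQ, k + 1 => by simpa using pmem_getD_of_pmem2 hQ k

/-- **Every entry of the shadow table lies in the corresponding interval entry.** [folklore] -/
theorem mem_coeff2_of_pmem2 {S : ℕ} {Q : List (List ℝ)} {QI : IPoly2} (h : PMem2 S Q QI) (m k : ℕ) :
    MI.mem S (coeff2 Q m k) (coeff2I QI m k) :=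
  mem_getD_of_pmem (pmem_getD_of_pmem2 h k) m

/-- A common bound for the outer length and all row lengths (interval side). [folklore] -/
def size2I (QI : IPoly2) : ℕ := QI.foldr (fun l n => max l.length n) QI.length

/-- [folklore] -/
theorem length_eq_of_pmem {S : ℕ} {as : List ℝ} {P : IPoly} (h : PMem S as P) : as.length = P.length :=
  List.Forall₂.length_eq h

/-- **The shadow's `size2` is the twin's `size2I`** (so the index range of the expansion theorems is computable).
[folklore] -/
theorem size2_eq_of_pmem2 {S : ℕ} {Q : List (List ℝ)} {QI : IPoly2} (h : PMem2 S Q QI) : size2 Q = size2I QI := by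
  unfold size2 size2I
  rw [List.Forall₂.length_eq h]
  generalize QI.length = n
  induction h with
  | nil => rfl
  | cons hp _ ih => simp only [List.foldr_cons, length_eq_of_pmem hp, ih]

end Summit.CriticalPhenomena.Ising3D
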